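import Mathlib
import HarnessLib.Audit
import Summits.PneNP.PneNP.Theorems.PstarCleanCut

/-!
# No clean cut is crossed twice; the census node restricted to skeleton-connected chords (ROUND-24, O1; memo g24 §33)

FRONTIER range-avoidance ladder, rung F-N3, ROUND 24 (cell `pnp-ideate`, prover-2 memo `g24/O1-NOFREEVERTEX-g24.md` §33; typed targets
`PstarCoreBoundTargets.TerminalFive` / `TerminalPeelable` (p646951); restricted-model proof complexity — nothing here bears on `P` versus `NP`).

Continuation of `PstarCleanCut` inside the core-bound induction (every proper terminal sub-core has at most five members):

* **`false_of_cleanCut_two`** — a terminal core has no clean cut (`PstarCleanCut.CleanCut`) crossed by two distinct members: both would be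
  slice-generic (`PstarCleanCut.smallCriterion_of_crossing` + the induction hypothesis via `PstarTerminalFiveAssembly.noPathSumSubcoreLin_of_small`),
  against `PstarChordReadTwoClean.false_of_two_clean`.  Hence (`NoTwoCrossings`) the skeleton of a terminal core has at most two groups of
  components joined by clean chords, with at most ONE joining chord in all; with hereditary expansion this forces boundary slack `t ≥ 1` on every
  centre structure (memo §33.4) — no terminal core with a centre at maximal sharing, inside the induction.
* `SkConnected` (the endpoints of a chord are not separated by any clean cut), node **`CleanCutCriterionBound`** (OPEN, census-type: on covered,
  anchored structures with `NoTwoCrossings`, only SKELETON-CONNECTED outside-gated chords outside `ℬ` are tested) and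
  **`terminalFive_of_cutBound : TerminalFiveA → CleanCutCriterionBound → TerminalFive`** — the assembly by strong induction on `#J₀`, as
  `PstarTerminalFiveAssembly.terminalFive_of_bound`, the chords crossing a clean cut being discharged by `smallCriterion_of_crossing`;
  `terminalPeelable_of_cutBound`.
-/

set_option linter.dupNamespace false -- `Summit.PneNP.PneNP.…`: summit = sub-problem name (D-0017 single-conjunct layout)

open Finset Literature.Computability.Complexity
open Summit.PneNP.PneNP.Theorems.PstarTyped (Typed)
open Summit.PneNP.PneNP.Theorems.PstarSALevel (varSet bdry BoundaryExpanding SimpleOverlap)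
open Summit.PneNP.PneNP.Theorems.PstarXCore (xpair mem_xpair xverts)
open Summit.PneNP.PneNP.Theorems.PstarCoreBound (XorClosed)
open Summit.PneNP.PneNP.Theorems.PstarChordRepair (IsChord)
open Summit.PneNP.PneNP.Theorems.PstarCoreBoundTargets (Terminal TerminalFive TerminalFiveA TerminalPeelable nonchords nonchords_subset mem_nonchords
  terminalPeelable_of_terminalFive)
open Summit.PneNP.PneNP.Theorems.PstarSharingBound (sharedSlots)
open Summit.PneNP.PneNP.Theorems.PstarChordBridgeTools (xpdeg)
open Summit.PneNP.PneNP.Theorems.PstarChordBridgeCentre (exists_maximal_peelable_sup)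
open Summit.PneNP.PneNP.Theorems.PstarChordReadOutside (OutsideGated)
open Summit.PneNP.PneNP.Theorems.PstarChordReadLemma (SliceGeneric)
open Summit.PneNP.PneNP.Theorems.PstarChordReadTwoClean (false_of_two_clean)
open Summit.PneNP.PneNP.Theorems.PstarCleanChordCount (exists_clean_chords)
open Summit.PneNP.PneNP.Theorems.PstarTerminalPeelableTwelve (exists_centre_of_not_peelable)
open Summit.PneNP.PneNP.Theorems.PstarSliceGenericCriterion (NoShortCoincidence sliceGeneric_of_criterionLin)
open Summit.PneNP.PneNP.Theorems.PstarSliceGenericInternal (internalMenu internalMenu_subset sliceGeneric_of_internal)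
open Summit.PneNP.PneNP.Theorems.PstarTerminalFiveAssembly (NoSmallPathSumSubcore noPathSumSubcoreLin_of_small)
open Summit.PneNP.PneNP.Theorems.PstarSkeletalSubcores (NoSkeletalPathSumSubcore noSmallPathSumSubcore_of_skeletal)
open Summit.PneNP.PneNP.Theorems.PstarNoFreeVertex (Covered covered_of_terminal)
open Summit.PneNP.PneNP.Theorems.PstarHangingForest (Anchored anchored_of_terminal)
open Summit.PneNP.PneNP.Theorems.PstarCleanCut (Crosses CleanCut smallCriterion_of_crossing)

namespace Summit.PneNP.PneNP.Theorems.PstarCleanCutAssembly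

variable {n m : ℕ} {I : LocalMap 4 n m} {r : ℕ} {y : Fin m → Bool}

/-! ## Inside the core-bound induction: no clean cut is crossed twice -/

/-- **NO TWO CROSSINGS OF A CLEAN CUT**, given that every proper terminal sub-core has at most five members (the induction hypothesis of the
core bound): two distinct members crossing a clean cut of a terminal core would both be slice-generic. -/
theorem false_of_cleanCut_two (hI : I.IsPure xorAndPred) (hT : Typed I) (hS : SimpleOverlap I) (hB : BoundaryExpanding r I)
    {K : Finset (Fin m)} {d₁ d₂ : Finset (Fin n) × Finset (Fin m) × Bool} (ht : Terminal I r y K d₁ d₂)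
    (hIH : ∀ c ∈ K, ∀ K₀ ⊆ K.erase c, ∀ d d' : Finset (Fin n) × Finset (Fin m) × Bool, Terminal I r y K₀ d d' → K₀.card ≤ 5)
    {W : Finset (Fin n)} (hcut : CleanCut I K (d₁.2.1 ∪ d₂.2.1) W) {e₁ e₂ : Fin m} (he₁ : e₁ ∈ K) (he₂ : e₂ ∈ K) (hne : e₁ ≠ e₂)
    (hc₁ : Crosses I W e₁) (hc₂ : Crosses I W e₂) : False := by
  have hKr : K.card < r := ht.2.2.1
  have hdisj : Disjoint K (d₁.2.1 ∪ d₂.2.1) := disjoint_union_right.2 ⟨ht.2.2.2.1, ht.2.2.2.2.1⟩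
  have hr : (K ∪ (d₁.2.1 ∪ d₂.2.1)).card ≤ r := by rw [← union_assoc]; exact ht.2.2.2.2.2.1
  have hM' : internalMenu I K (d₁.2.1 ∪ d₂.2.1) ⊆ d₁.2.1 ∪ d₂.2.1 := internalMenu_subset I K _
  have hdisj' : Disjoint K (internalMenu I K (d₁.2.1 ∪ d₂.2.1)) := hdisj.mono_right hM'
  have hr' : (K ∪ internalMenu I K (d₁.2.1 ∪ d₂.2.1)).card ≤ r := (card_le_card (union_subset_union (Subset.refl _) hM')).trans hr
  have hgen : ∀ e ∈ K, Crosses I W e → SliceGeneric I y K e (d₁.2.1 ∪ d₂.2.1) := by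
    intro e he hce
    obtain ⟨hch, hO⟩ := hcut e he hce
    obtain ⟨hA, hBe⟩ := smallCriterion_of_crossing (y := y) hI hT hS hB hdisj hcut hce
    exact sliceGeneric_of_internal hI hT hS hB hKr.le he hch hO
      (sliceGeneric_of_criterionLin hI hT hS hB he hdisj' hr' (noPathSumSubcoreLin_of_small (hIH e he) hA) hBe)
  obtain ⟨hch₁, hO₁⟩ := hcut e₁ he₁ hc₁
  obtain ⟨hch₂, hO₂⟩ := hcut e₂ he₂ hc₂
  exact false_of_two_clean hI hT hS hB ht he₁ he₂ hne hch₁ hch₂ hO₁ hO₂ (hgen e₁ he₁ hc₁) (hgen e₂ he₂ hc₂)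

/-! ## The census node restricted to skeleton-connected chords, and the core bound from it -/

/-- **SKELETON-CONNECTED chord**: every vertex set separating the XOR endpoints of `c` is crossed by a member of `J₀` that is NOT an
outside-gated chord (menu `𝒢`) — the endpoints of `c` lie in one connected component of the skeleton. -/
def SkConnected (I : LocalMap 4 n m) (J₀ 𝒢 : Finset (Fin m)) (c : Fin m) : Prop :=
  ∀ W : Finset (Fin n), Crosses I W c → ∃ f ∈ J₀, Crosses I W f ∧ ¬ (IsChord I J₀ f ∧ OutsideGated I J₀ 𝒢 f)

/-- **NO TWO CROSSINGS**: no clean cut of `J₀` (menu `𝒢`) is crossed by two distinct members. -/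
def NoTwoCrossings (I : LocalMap 4 n m) (J₀ 𝒢 : Finset (Fin m)) : Prop :=
  ∀ (W : Finset (Fin n)) (e₁ e₂ : Fin m), e₁ ∈ J₀ → e₂ ∈ J₀ → e₁ ≠ e₂ → Crosses I W e₁ → Crosses I W e₂ → ¬ CleanCut I J₀ 𝒢 W

/-- **`CleanCutCriterionBound` (OPEN, census-type)**: on every terminal core with a centre that is `Covered`, `Anchored` and has
`NoTwoCrossings` (all three hold for terminal cores, the last inside the induction), there is `ℬ ⊆ J₀` with `#ℬ + 2 ≤ #sharedSlots` such that every
SKELETON-CONNECTED outside-gated chord outside `ℬ` satisfies `NoSkeletalPathSumSubcore` and `NoShortCoincidence` (internal menu).  Chords joining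
two skeleton components are exempt (`PstarCleanCut.smallCriterion_of_crossing`).  FRONTIER. -/
@[conjecture] def CleanCutCriterionBound : Prop :=
  ∀ (n m r : ℕ) (I : LocalMap 4 n m), I.IsPure xorAndPred → Typed I → SimpleOverlap I → BoundaryExpanding r I →
    ∀ (y : Fin m → Bool) (J₀ : Finset (Fin m)) (w₁ w₂ : Finset (Fin n) × Finset (Fin m) × Bool), Terminal I r y J₀ w₁ w₂ →
      (∃ S ⊆ J₀, S.Nonempty ∧ (∀ w ∈ xverts I S, 2 ≤ xpdeg I S w) ∧ ∀ f ∈ S, ¬ IsChord I J₀ f) →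
      Covered I J₀ (w₁.2.1 ∪ w₂.2.1) → Anchored I J₀ (w₁.2.1 ∪ w₂.2.1) → NoTwoCrossings I J₀ (w₁.2.1 ∪ w₂.2.1) →
      ∃ ℬ ⊆ J₀, ℬ.card + 2 ≤ (sharedSlots I J₀).card ∧
        ∀ c ∈ J₀, c ∉ ℬ → IsChord I J₀ c → OutsideGated I J₀ (w₁.2.1 ∪ w₂.2.1) c → SkConnected I J₀ (w₁.2.1 ∪ w₂.2.1) c →
          NoSkeletalPathSumSubcore I r y J₀ c (w₁.2.1 ∪ w₂.2.1) ∧ NoShortCoincidence I J₀ c (internalMenu I J₀ (w₁.2.1 ∪ w₂.2.1))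

/-- **THE CORE BOUND FROM O2 AND THE CUT-RESTRICTED CRITERION BOUND** — strong induction on `#J₀` (as
`PstarTerminalFiveAssembly.terminalFive_of_bound`): in the centre case, a clean chord outside `ℬ` either crosses a clean cut
(`smallCriterion_of_crossing`) or is skeleton-connected (the node); two such chords are slice-generic by the induction hypothesis on sub-cores. -/
theorem terminalFive_of_cutBound (hO2 : TerminalFiveA) (hb : CleanCutCriterionBound) : TerminalFive := by
  classical
  suffices H : ∀ (k n m r : ℕ) (I : LocalMap 4 n m), I.IsPure xorAndPred → Typed I → SimpleOverlap I → BoundaryExpanding r I →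
      ∀ (y : Fin m → Bool) (J₀ : Finset (Fin m)) (w₁ w₂ : Finset (Fin n) × Finset (Fin m) × Bool), Terminal I r y J₀ w₁ w₂ →
        J₀.card = k → J₀.card ≤ 5 from
    fun n m r I hI hT hS hB y J₀ w₁ w₂ ht => H _ n m r I hI hT hS hB y J₀ w₁ w₂ ht rfl
  intro k
  induction k using Nat.strong_induction_on with
  | _ k ih =>
    intro n m r I hI hT hS hB y J₀ w₁ w₂ ht hk
    by_cases hP : PstarChordBridgeCotree.Peelable I (nonchords I J₀)
    · -- no centre cycle: Assumption A holds, O2 applies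
      obtain ⟨F, hS₀F, hFJ, hPF, hmax⟩ := exists_maximal_peelable_sup I (nonchords_subset I J₀) hP
      refine hO2 n m r I hI hT hS hB y J₀ w₁ w₂ ht F hFJ hPF hmax fun e he => ?_
      rw [mem_sdiff] at he
      by_contra hc
      exact he.2 (hS₀F ((mem_nonchords I).2 ⟨he.1, hc⟩))
    · exfalso
      obtain ⟨S, hSJ, hne, hL, hnc⟩ := exists_centre_of_not_peelable I hP
      have hdisj : Disjoint J₀ (w₁.2.1 ∪ w₂.2.1) := disjoint_union_right.2 ⟨ht.2.2.2.1, ht.2.2.2.2.1⟩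
      have hr : (J₀ ∪ (w₁.2.1 ∪ w₂.2.1)).card ≤ r := by rw [← union_assoc]; exact ht.2.2.2.2.2.1
      set 𝒢 := w₁.2.1 ∪ w₂.2.1 with h𝒢
      have hdisjI : Disjoint J₀ (internalMenu I J₀ 𝒢) := hdisj.mono_right (internalMenu_subset I J₀ 𝒢)
      have hrI : (J₀ ∪ internalMenu I J₀ 𝒢).card ≤ r :=
        (card_le_card (union_subset_union (Subset.refl _) (internalMenu_subset I J₀ 𝒢))).trans hr
      -- induction hypothesis: proper terminal sub-cores have at most five outputs
      have hIH : ∀ c ∈ J₀, ∀ K₀ ⊆ J₀.erase c, ∀ d₁ d₂ : Finset (Fin n) × Finset (Fin m) × Bool, Terminal I r y K₀ d₁ d₂ → K₀.card ≤ 5 := by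
        intro c hc K₀ hK₀ d₁ d₂ ht₀
        have hlt : K₀.card < k := by
          rw [← hk]
          exact lt_of_le_of_lt (card_le_card hK₀) (card_erase_lt_of_mem hc)
        exact ih K₀.card hlt n m r I hI hT hS hB y K₀ d₁ d₂ ht₀ rfl
      have hN2 : NoTwoCrossings I J₀ 𝒢 := fun W e₁ e₂ he₁ he₂ hne hc₁ hc₂ hcut =>
        false_of_cleanCut_two hI hT hS hB ht hIH hcut he₁ he₂ hne hc₁ hc₂
      obtain ⟨ℬ, -, hℬ, hgood⟩ := hb n m r I hI hT hS hB y J₀ w₁ w₂ ht ⟨S, hSJ, hne, hL, hnc⟩ (covered_of_terminal hI hT hS hB ht)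
        (anchored_of_terminal hI hT hS hB ht) hN2
      obtain ⟨𝒞, h𝒞J, hch, hO, hcard⟩ := exists_clean_chords hB ht
      have hU : 1 < (𝒞 \ ℬ).card := by
        have := le_card_sdiff ℬ 𝒞
        omega
      obtain ⟨a, ha, b, hb', hab⟩ := one_lt_card.1 hU
      obtain ⟨ha𝒞, haℬ⟩ := mem_sdiff.1 ha
      obtain ⟨hb𝒞, hbℬ⟩ := mem_sdiff.1 hb'
      -- a clean chord outside `ℬ` passes the small criterion: crossing a clean cut, or skeleton-connected and certified by the node
      have hcrit : ∀ c ∈ 𝒞, c ∉ ℬ →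
          NoSmallPathSumSubcore I r y J₀ c (internalMenu I J₀ 𝒢) ∧ NoShortCoincidence I J₀ c (internalMenu I J₀ 𝒢) := by
        intro c hc hcℬ
        by_cases hsk : SkConnected I J₀ 𝒢 c
        · obtain ⟨hA, hBc⟩ := hgood c (h𝒞J hc) hcℬ (hch c hc) (hO c hc) hsk
          exact ⟨noSmallPathSumSubcore_of_skeletal hI hT hS hB hdisj hA, hBc⟩
        · unfold SkConnected at hsk
          push Not at hsk
          obtain ⟨W, hcW, hcut⟩ := hsk
          exact smallCriterion_of_crossing hI hT hS hB hdisj (fun f hf hcf => hcut f hf hcf) hcW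
      have hgen : ∀ c ∈ 𝒞, c ∉ ℬ → SliceGeneric I y J₀ c 𝒢 := by
        intro c hc hcℬ
        obtain ⟨hA, hBc⟩ := hcrit c hc hcℬ
        exact sliceGeneric_of_internal hI hT hS hB ht.2.2.1.le (h𝒞J hc) (hch c hc) (hO c hc)
          (sliceGeneric_of_criterionLin hI hT hS hB (h𝒞J hc) hdisjI hrI (noPathSumSubcoreLin_of_small (hIH c (h𝒞J hc)) hA) hBc)
      exact false_of_two_clean hI hT hS hB ht (h𝒞J ha𝒞) (h𝒞J hb𝒞) hab (hch a ha𝒞) (hch b hb𝒞) (hO a ha𝒞) (hO b hb𝒞)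
        (hgen a ha𝒞 haℬ) (hgen b hb𝒞 hbℬ)

/-- **O1 from the same inputs.** -/
theorem terminalPeelable_of_cutBound (hO2 : TerminalFiveA) (hb : CleanCutCriterionBound) : TerminalPeelable :=
  terminalPeelable_of_terminalFive (terminalFive_of_cutBound hO2 hb)

end Summit.PneNP.PneNP.Theorems.PstarCleanCutAssembly
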